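import Literature.MathematicalPhysics.QuantumLattice.HubbardPolymerBounds
import HarnessLib

/-!
# Bounds — Theorem 13_N kernel device, part F-S: the one-site partition function at complex fugacity

HONEST FRAMING: ladder R1–R4 with certified numbers; no claim on H/H₀; bounds for model
classes, no materials claim.

Single-site inequalities of bounds.tex §13, Lemma 13.1 (c), in the N-sector (one fugacity
variable) form used by the kernel device of Theorem 13_N (LEAN FILING REQUEST #211).  With
`z(w) = 1 + 2 e^w + e^{2w - v}` (`= atomicPartitionFn β U (w/β)` for real `β ≠ 0`, `U`, and
`v = βU`), `s = Re w`, `φ = Im w`: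

* the exact modulus `‖z(w)‖² = z(s)² − 4 e^s (1 + e^{2s−v}) (1 − cos φ) − 2 e^{2s−v} (1 − cos 2φ)`
  (`normSq_atomicC_eq`);
* ON THE ARC `cos φ ≥ c₀ ≥ 0`, `v ≥ −u₀`: `‖z(w)‖² ≥ z(s)² · (1 − (1−c₀)/2 − (1−c₀²)/(1+e^{−u₀/2})²)`
  (`normSq_atomicC_arc_lower`), hence `siteRatio β U (w/β) ≤ R` whenever
  `1 ≤ R² · (1 − (1−c₀)/2 − (1−c₀²)/(1+e^{−u₀/2})²)` (`siteRatio_le_of_arc`) and `z(w) ≠ 0`;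
* OFF THE ARC `cos φ ≤ c₀ ≤ 1`, `|v| ≤ u₀`: `‖z(w)‖² ≤ z(s)² · (1 − (1−c₀) · 2n(2−n) / ((1+e^{u₀})(1+e^{u₀/2})))`
  with `n = (2e^s + 2e^{2s−v})/z(s)` the atomic density (`normSq_atomicC_offarc_density`), hence
  the per-site loss `‖z(w)‖ ≤ z(s) · exp (−κ)`, `κ = (1−c₀) n(2−n) / ((1+e^{u₀})(1+e^{u₀/2}))`
  (`norm_atomicC_le_mul_exp_neg_offarc`).

All statements are elementary real inequalities (AM–GM `1 + e^{2s−v} ≥ 2e^{s−v/2}` and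
`z(s)² ≥ 8 e^s (1 + e^{2s−v})`); 0 sorry.  Imports: landed Literature only.
-/

noncomputable section

namespace Summit.HubbardSuperconductivity.HubbardLadder.Bounds

open Complex Literature.MathematicalPhysics.QuantumLattice

/-- The complex one-site partition function in the fugacity variable `w = βμ`:
`atomicPartitionFn β U (w/β) = 1 + 2 e^w + e^{2w − βU}` for real `β ≠ 0`, `U`.
[this programme: bounds.tex §13, Lemma 13.1 (c)] -/
theorem atomicPartitionFn_div_eq (β U : ℝ) (hβ : β ≠ 0) (w : ℂ) :
    atomicPartitionFn (β : ℂ) (U : ℂ) (w / β) = 1 + 2 * cexp w + cexp (2 * w - (β * U : ℝ)) := by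
  have hβ' : (β : ℂ) ≠ 0 := Complex.ofReal_ne_zero.2 hβ
  unfold atomicPartitionFn
  rw [mul_div_cancel₀ w hβ']
  congr 2
  push_cast
  field_simp
  ring

/-- The real one-site partition function at `β = 1`: `z(s) = 1 + 2 e^s + e^{2s − v}`. [folklore] -/
theorem atomicPartitionFnReal_one_eq (v s : ℝ) :
    atomicPartitionFnReal 1 v s = 1 + 2 * Real.exp s + Real.exp (2 * s - v) := by
  unfold atomicPartitionFnReal
  congr 1 <;> [congr 2; congr 1] <;> ring

/-- The site ratio in the fugacity variable: `siteRatio β U (w/β) = z(Re w) / ‖z(w)‖`, where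
`z(s) = 1 + 2e^s + e^{2s − βU}`. [this programme: bounds.tex §13, Lemma 13.1 (c)] -/
theorem siteRatio_div_eq (β U : ℝ) (hβ : β ≠ 0) (w : ℂ) :
    siteRatio (β : ℂ) (U : ℂ) (w / β)
      = (1 + 2 * Real.exp w.re + Real.exp (2 * w.re - β * U))
          / ‖1 + 2 * cexp w + cexp (2 * w - (β * U : ℝ))‖ := by
  have hβ' : (β : ℂ) ≠ 0 := Complex.ofReal_ne_zero.2 hβ
  unfold siteRatio
  rw [atomicPartitionFn_div_eq β U hβ w, mul_div_cancel₀ w hβ', ← Complex.ofReal_mul, Complex.ofReal_re,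
    atomicPartitionFnReal_one_eq]

/-- The exact modulus of the complex one-site partition function:
`‖1 + 2e^w + e^{2w−v}‖² = z(s)² − 4e^s(1 + e^{2s−v})(1 − cos φ) − 2e^{2s−v}(1 − cos 2φ)`
(`s = Re w`, `φ = Im w`; the three-term trigonometric sum `|p₀ + p₁e^{iφ} + p₂e^{2iφ}|²`).
[this programme: bounds.tex §13, Lemma 13.1 (c), N-sector form] -/
theorem normSq_atomicC_eq (w : ℂ) (v : ℝ) :
    ‖1 + 2 * cexp w + cexp (2 * w - (v : ℝ))‖ ^ 2
      = (1 + 2 * Real.exp w.re + Real.exp (2 * w.re - v)) ^ 2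
        - 4 * Real.exp w.re * (1 + Real.exp (2 * w.re - v)) * (1 - Real.cos w.im)
        - 2 * Real.exp (2 * w.re - v) * (1 - Real.cos (2 * w.im)) := by
  rw [Complex.sq_norm, Complex.normSq_apply]
  have hre : (2 * w - (v : ℝ) : ℂ).re = 2 * w.re - v := by simp
  have him : (2 * w - (v : ℝ) : ℂ).im = 2 * w.im := by simp
  simp only [Complex.add_re, Complex.add_im, Complex.one_re, Complex.one_im, Complex.mul_re,
    Complex.mul_im, Complex.exp_re, Complex.exp_im, hre, him, Complex.re_ofNat, Complex.im_ofNat]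
  have hc2 : Real.cos (2 * w.im) = 2 * Real.cos w.im ^ 2 - 1 := Real.cos_two_mul w.im
  have hs2 : Real.sin (2 * w.im) = 2 * Real.sin w.im * Real.cos w.im := Real.sin_two_mul w.im
  rw [hc2, hs2]
  linear_combination (4 * (Real.exp w.re + Real.exp (2 * w.re - v) * Real.cos w.im) ^ 2)
    * Real.sin_sq_add_cos_sq w.im

/-- `z(s)² ≥ 8 e^s (1 + e^{2s−v})`, i.e. `2A ≤ ½` for the one-site weights. [folklore: AM–GM] -/
theorem eight_mul_exp_mul_le_sq (s v : ℝ) :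
    8 * Real.exp s * (1 + Real.exp (2 * s - v)) ≤ (1 + 2 * Real.exp s + Real.exp (2 * s - v)) ^ 2 := by
  nlinarith [sq_nonneg (2 * Real.exp s - (1 + Real.exp (2 * s - v)))]

/-- AM–GM for the vacuum and the pair: `2 e^{s − v/2} ≤ 1 + e^{2s − v}`. [folklore] -/
theorem two_mul_exp_le_one_add_exp (s v : ℝ) :
    2 * Real.exp (s - v / 2) ≤ 1 + Real.exp (2 * s - v) := by
  have h : Real.exp (2 * s - v) = Real.exp (s - v / 2) ^ 2 := by
    rw [← Real.exp_nat_mul]; congr 1; push_cast; ring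
  rw [h]
  nlinarith [sq_nonneg (Real.exp (s - v / 2) - 1)]

/-- `4 e^{2s−v} (1 + e^{−u₀/2})² ≤ z(s)²` for `v ≥ −u₀`, i.e. `4P ≤ (1 + e^{−u₀/2})^{−2}` for the
one-site weights. [this programme: bounds.tex §13, Lemma 13.1 (c), N-sector form] -/
theorem four_mul_exp_mul_sq_le_sq (s v u₀ : ℝ) (hv : -u₀ ≤ v) :
    4 * Real.exp (2 * s - v) * (1 + Real.exp (-(u₀ / 2))) ^ 2
      ≤ (1 + 2 * Real.exp s + Real.exp (2 * s - v)) ^ 2 := by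
  set m := Real.exp (s - v / 2) with hm
  have hm0 : 0 ≤ m := (Real.exp_pos _).le
  have he2 : Real.exp (2 * s - v) = m ^ 2 := by
    rw [hm, ← Real.exp_nat_mul]; congr 1; push_cast; ring
  have hmE : m * Real.exp (-(u₀ / 2)) ≤ Real.exp s := by
    rw [hm, ← Real.exp_add]
    exact Real.exp_le_exp.2 (by linarith)
  have h1 : 2 * m ≤ 1 + Real.exp (2 * s - v) := two_mul_exp_le_one_add_exp s v
  -- `2 m (1 + e^{-u₀/2}) ≤ z(s)`
  have h2 : 2 * m * (1 + Real.exp (-(u₀ / 2))) ≤ 1 + 2 * Real.exp s + Real.exp (2 * s - v) := by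
    nlinarith
  have h3 : 0 ≤ 2 * m * (1 + Real.exp (-(u₀ / 2))) := by positivity
  calc 4 * Real.exp (2 * s - v) * (1 + Real.exp (-(u₀ / 2))) ^ 2
      = (2 * m * (1 + Real.exp (-(u₀ / 2)))) ^ 2 := by rw [he2]; ring
    _ ≤ (1 + 2 * Real.exp s + Real.exp (2 * s - v)) ^ 2 := pow_le_pow_left₀ h3 h2 2

/-- **On the arc.** If `cos (Im w) ≥ c₀ ≥ 0` and `v ≥ −u₀` then
`‖1 + 2e^w + e^{2w−v}‖² ≥ z(Re w)² · (1 − (1−c₀)/2 − (1−c₀²)/(1+e^{−u₀/2})²)`.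
[this programme: bounds.tex §13, Lemma 13.1 (c) (lower bound on the tube), N-sector form] -/
theorem normSq_atomicC_arc_lower (w : ℂ) (v c₀ u₀ : ℝ) (hc₀ : 0 ≤ c₀) (hc : c₀ ≤ Real.cos w.im)
    (hv : -u₀ ≤ v) :
    (1 + 2 * Real.exp w.re + Real.exp (2 * w.re - v)) ^ 2
        * (1 - (1 - c₀) / 2 - (1 - c₀ ^ 2) / (1 + Real.exp (-(u₀ / 2))) ^ 2)
      ≤ ‖1 + 2 * cexp w + cexp (2 * w - (v : ℝ))‖ ^ 2 := by
  rw [normSq_atomicC_eq]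
  set e1 := Real.exp w.re
  set e2 := Real.exp (2 * w.re - v)
  set z := 1 + 2 * e1 + e2 with hz
  set D := 1 + Real.exp (-(u₀ / 2)) with hD
  have hD0 : 0 < D := by positivity
  have he1 : 0 < e1 := Real.exp_pos _
  have he2 : 0 < e2 := Real.exp_pos _
  have hcos1 : Real.cos w.im ≤ 1 := Real.cos_le_one _
  -- first loss term
  have ha : 4 * e1 * (1 + e2) * (1 - Real.cos w.im) ≤ z ^ 2 / 2 * (1 - c₀) := by
    have h8 : 8 * e1 * (1 + e2) ≤ z ^ 2 := eight_mul_exp_mul_le_sq w.re v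
    nlinarith
  -- second loss term
  have hcsq : c₀ ^ 2 ≤ Real.cos w.im ^ 2 := pow_le_pow_left₀ hc₀ hc 2
  have hb : 2 * e2 * (1 - Real.cos (2 * w.im)) ≤ z ^ 2 * (1 - c₀ ^ 2) / D ^ 2 := by
    have h4 : 4 * e2 * D ^ 2 ≤ z ^ 2 := four_mul_exp_mul_sq_le_sq w.re v u₀ hv
    have hc2 : Real.cos (2 * w.im) = 2 * Real.cos w.im ^ 2 - 1 := Real.cos_two_mul w.im
    have h1c : 0 ≤ 1 - c₀ ^ 2 := by nlinarith
    rw [hc2, le_div_iff₀ (by positivity)]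
    have h5 : 4 * e2 * D ^ 2 * c₀ ^ 2 ≤ 4 * e2 * D ^ 2 * Real.cos w.im ^ 2 :=
      mul_le_mul_of_nonneg_left hcsq (by positivity)
    nlinarith [mul_le_mul_of_nonneg_right h4 h1c, h5]
  have hsplit : z ^ 2 * (1 - (1 - c₀) / 2 - (1 - c₀ ^ 2) / D ^ 2)
      = z ^ 2 - z ^ 2 / 2 * (1 - c₀) - z ^ 2 * (1 - c₀ ^ 2) / D ^ 2 := by ring
  rw [hsplit]
  linarith

/-- **Off the arc.** If `cos (Im w) ≤ c₀` then
`‖1 + 2e^w + e^{2w−v}‖² ≤ z(Re w)² − 4e^{Re w}(1 + e^{2 Re w − v})(1 − c₀)`.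
[this programme: bounds.tex §13, Lemma 13.1 (c) (upper bound), N-sector form] -/
theorem normSq_atomicC_offarc_upper (w : ℂ) (v c₀ : ℝ) (hc : Real.cos w.im ≤ c₀) :
    ‖1 + 2 * cexp w + cexp (2 * w - (v : ℝ))‖ ^ 2
      ≤ (1 + 2 * Real.exp w.re + Real.exp (2 * w.re - v)) ^ 2
        - 4 * Real.exp w.re * (1 + Real.exp (2 * w.re - v)) * (1 - c₀) := by
  rw [normSq_atomicC_eq]
  have he1 : 0 < Real.exp w.re := Real.exp_pos _
  have he2 : 0 < Real.exp (2 * w.re - v) := Real.exp_pos _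
  have hcos : Real.cos (2 * w.im) ≤ 1 := Real.cos_le_one _
  nlinarith [mul_pos he1 (add_pos one_pos he2)]

/-- The density identity behind the off-arc bound: with `z = 1 + 2e1 + e2`,
`4 (e1 + e2) (1 + e1) = n (2 − n) z²` for the atomic density `n = (2e1 + 2e2)/z`; here in the
cleared form `(2e1 + 2e2)(2z − (2e1 + 2e2)) = 4 (e1 + e2)(1 + e1)`. [folklore] -/
theorem density_clear (e1 e2 : ℝ) :
    (2 * e1 + 2 * e2) * (2 * (1 + 2 * e1 + e2) - (2 * e1 + 2 * e2)) = 4 * (e1 + e2) * (1 + e1) := by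
  ring

/-- **Off the arc, density form.** If `cos (Im w) ≤ c₀ ≤ 1` and `|v| ≤ u₀` then, with
`z = z(Re w)` and `n = (2e^{Re w} + 2e^{2Re w − v})/z` the atomic density,
`‖1 + 2e^w + e^{2w−v}‖² ≤ z² · (1 − (1−c₀) · 2n(2−n) / ((1+e^{u₀})(1+e^{u₀/2})))`.
[this programme: bounds.tex §13, Lemma 13.1 (c) + proof of Lemma 13.2, N-sector form] -/
theorem normSq_atomicC_offarc_density (w : ℂ) (v c₀ u₀ : ℝ) (hc : Real.cos w.im ≤ c₀) (hc1 : c₀ ≤ 1)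
    (hv : |v| ≤ u₀) :
    ‖1 + 2 * cexp w + cexp (2 * w - (v : ℝ))‖ ^ 2
      ≤ (1 + 2 * Real.exp w.re + Real.exp (2 * w.re - v)) ^ 2
        * (1 - (1 - c₀) * (2 * (((2 * Real.exp w.re + 2 * Real.exp (2 * w.re - v))
              / (1 + 2 * Real.exp w.re + Real.exp (2 * w.re - v)))
            * (2 - (2 * Real.exp w.re + 2 * Real.exp (2 * w.re - v))
              / (1 + 2 * Real.exp w.re + Real.exp (2 * w.re - v)))))
            / ((1 + Real.exp u₀) * (1 + Real.exp (u₀ / 2)))) := by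
  refine (normSq_atomicC_offarc_upper w v c₀ hc).trans ?_
  set e1 := Real.exp w.re with he1d
  set e2 := Real.exp (2 * w.re - v) with he2d
  set z := 1 + 2 * e1 + e2 with hz
  set E := Real.exp u₀ with hE
  set E2 := Real.exp (u₀ / 2) with hE2
  have he1 : 0 < e1 := Real.exp_pos _
  have he2 : 0 < e2 := Real.exp_pos _
  have hz0 : 0 < z := by positivity
  have hE1 : 1 ≤ E := Real.one_le_exp (le_trans (abs_nonneg v) hv)
  have hE20 : 0 < E2 := Real.exp_pos _
  have hvu : v ≤ u₀ := (le_abs_self v).trans hv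
  have hvu' : -v ≤ u₀ := (neg_le_abs v).trans hv
  -- (i) `(1 + e2) E2 ≥ 2 e1`
  have hi : 2 * e1 ≤ (1 + e2) * E2 := by
    have h1 : 2 * Real.exp (w.re - v / 2) ≤ 1 + e2 := two_mul_exp_le_one_add_exp w.re v
    have h2 : e1 ≤ Real.exp (w.re - v / 2) * E2 := by
      rw [he1d, hE2, ← Real.exp_add]; exact Real.exp_le_exp.2 (by linarith)
    nlinarith
  -- (ii) `e1 z (E − 1) ≥ 2 e1² (e^{−v} − 1)`, i.e. `2 e1 (1+E) z ≥ 2 · 4 (e1+e2)(1+e1)`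
  have he2' : e2 = e1 ^ 2 * Real.exp (-v) := by
    rw [he2d, he1d, ← Real.exp_nat_mul, ← Real.exp_add]; ring_nf
  have hEv : Real.exp (-v) ≤ E := Real.exp_le_exp.2 hvu'
  have hii : 4 * (e1 + e2) * (1 + e1) ≤ 2 * e1 * (1 + E) * z := by
    have hz2 : 2 * e1 ≤ z := by rw [hz]; linarith
    have step1 : 4 * e1 ^ 2 * (Real.exp (-v) - 1) ≤ 4 * e1 ^ 2 * (E - 1) :=
      mul_le_mul_of_nonneg_left (by linarith) (by positivity)
    have step2 : 4 * e1 ^ 2 * (E - 1) ≤ 2 * e1 * z * (E - 1) := by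
      apply mul_le_mul_of_nonneg_right _ (by linarith)
      nlinarith
    have hid : 4 * (e1 + e2) * (1 + e1) = 4 * e1 * z + 4 * e1 ^ 2 * (Real.exp (-v) - 1) := by
      rw [hz, he2']; ring
    rw [hid]
    nlinarith
  -- combine: `4 e1 (1+e2) (1+E)(1+E2) ≥ 2 · 4 (e1+e2)(1+e1)`
  have hi' : z ≤ (1 + e2) * (1 + E2) := by rw [hz]; nlinarith [hi]
  have hprod : 2 * (4 * (e1 + e2) * (1 + e1)) ≤ 4 * e1 * (1 + e2) * ((1 + E) * (1 + E2)) := by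
    have hmul : 4 * (e1 + e2) * (1 + e1) * z ≤ 2 * e1 * (1 + E) * z * ((1 + e2) * (1 + E2)) :=
      mul_le_mul hii hi' hz0.le (by positivity)
    have hmul' : 4 * (e1 + e2) * (1 + e1) * z ≤ (2 * e1 * (1 + e2) * ((1 + E) * (1 + E2))) * z := by
      calc _ ≤ _ := hmul
        _ = _ := by ring
    have hQ := le_of_mul_le_mul_right hmul' hz0
    linarith
  have hden : 0 < (1 + E) * (1 + E2) := by positivity
  -- rewrite the density expression
  have hn : ((2 * e1 + 2 * e2) / z) * (2 - (2 * e1 + 2 * e2) / z) = 4 * (e1 + e2) * (1 + e1) / z ^ 2 := by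
    field_simp
    rw [hz]; ring
  rw [hn]
  have h1c : 0 ≤ 1 - c₀ := by linarith
  have key : z ^ 2 * ((1 - c₀) * (2 * (4 * (e1 + e2) * (1 + e1) / z ^ 2)) / ((1 + E) * (1 + E2)))
      ≤ 4 * e1 * (1 + e2) * (1 - c₀) := by
    rw [show z ^ 2 * ((1 - c₀) * (2 * (4 * (e1 + e2) * (1 + e1) / z ^ 2)) / ((1 + E) * (1 + E2)))
        = (1 - c₀) * (2 * (4 * (e1 + e2) * (1 + e1))) / ((1 + E) * (1 + E2)) by
          field_simp]
    rw [div_le_iff₀ hden]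
    nlinarith [mul_le_mul_of_nonneg_left hprod h1c]
  nlinarith [key]

/-- **Off the arc: the per-site loss.** Under the hypotheses of `normSq_atomicC_offarc_density`,
`‖1 + 2e^w + e^{2w−v}‖ ≤ z(Re w) · exp (−κ)` with
`κ = (1−c₀) · n(2−n) / ((1+e^{u₀})(1+e^{u₀/2}))`, `n` the atomic density.
[this programme: bounds.tex §13, Lemma 13.2 (the volume factor), N-sector form] -/
theorem norm_atomicC_le_mul_exp_neg_offarc (w : ℂ) (v c₀ u₀ : ℝ) (hc : Real.cos w.im ≤ c₀) (hc1 : c₀ ≤ 1)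
    (hv : |v| ≤ u₀) :
    ‖1 + 2 * cexp w + cexp (2 * w - (v : ℝ))‖
      ≤ (1 + 2 * Real.exp w.re + Real.exp (2 * w.re - v))
        * Real.exp (-((1 - c₀) * (((2 * Real.exp w.re + 2 * Real.exp (2 * w.re - v))
              / (1 + 2 * Real.exp w.re + Real.exp (2 * w.re - v)))
            * (2 - (2 * Real.exp w.re + 2 * Real.exp (2 * w.re - v))
              / (1 + 2 * Real.exp w.re + Real.exp (2 * w.re - v))))
            / ((1 + Real.exp u₀) * (1 + Real.exp (u₀ / 2))))) := by
  have h := normSq_atomicC_offarc_density w v c₀ u₀ hc hc1 hv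
  set z := 1 + 2 * Real.exp w.re + Real.exp (2 * w.re - v) with hz
  set x := (1 - c₀) * (((2 * Real.exp w.re + 2 * Real.exp (2 * w.re - v)) / z)
            * (2 - (2 * Real.exp w.re + 2 * Real.exp (2 * w.re - v)) / z))
            / ((1 + Real.exp u₀) * (1 + Real.exp (u₀ / 2))) with hx
  have hz0 : 0 < z := by positivity
  have h' : ‖1 + 2 * cexp w + cexp (2 * w - (v : ℝ))‖ ^ 2 ≤ z ^ 2 * (1 - 2 * x) := by
    convert h using 2; rw [hx]; ring
  have hexp : 1 - 2 * x ≤ Real.exp (-x) ^ 2 := by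
    rw [← Real.exp_nat_mul]
    have := Real.add_one_le_exp (-(2 * x))
    convert this using 2 <;> [ring; (push_cast; ring)]
  have h2 : ‖1 + 2 * cexp w + cexp (2 * w - (v : ℝ))‖ ^ 2 ≤ (z * Real.exp (-x)) ^ 2 := by
    calc _ ≤ z ^ 2 * (1 - 2 * x) := h'
      _ ≤ z ^ 2 * Real.exp (-x) ^ 2 := mul_le_mul_of_nonneg_left hexp (by positivity)
      _ = (z * Real.exp (-x)) ^ 2 := by ring
  exact (pow_le_pow_iff_left₀ (norm_nonneg _) (by positivity) two_ne_zero).1 h2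

/-- **Arc: no zero.** If `cos (Im w) ≥ c₀ ≥ 0`, `βU ≥ −u₀` and the arc floor
`1 − (1−c₀)/2 − (1−c₀²)/(1+e^{−u₀/2})²` is positive, then `z₀(β, U, w/β) ≠ 0`.
[this programme: bounds.tex §13, Lemma 13.1 (c)/(e), N-sector form] -/
theorem atomicPartitionFn_ne_zero_of_arc (β U : ℝ) (hβ : β ≠ 0) (w : ℂ) (c₀ u₀ : ℝ) (hc₀ : 0 ≤ c₀)
    (hc : c₀ ≤ Real.cos w.im) (hv : -u₀ ≤ β * U)
    (hfloor : 0 < 1 - (1 - c₀) / 2 - (1 - c₀ ^ 2) / (1 + Real.exp (-(u₀ / 2))) ^ 2) :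
    atomicPartitionFn (β : ℂ) (U : ℂ) (w / β) ≠ 0 := by
  rw [atomicPartitionFn_div_eq β U hβ w, ← norm_pos_iff]
  have h := normSq_atomicC_arc_lower w (β * U) c₀ u₀ hc₀ hc hv
  have hz : 0 < 1 + 2 * Real.exp w.re + Real.exp (2 * w.re - β * U) := by positivity
  have hpos : 0 < ‖1 + 2 * cexp w + cexp (2 * w - (β * U : ℝ))‖ ^ 2 :=
    lt_of_lt_of_le (by positivity) h
  have h0 := norm_nonneg (1 + 2 * cexp w + cexp (2 * w - (β * U : ℝ)))
  rcases h0.lt_or_eq with hlt | heq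
  · exact hlt
  · rw [← heq] at hpos; norm_num at hpos

/-- **Arc: the site ratio.** If `cos (Im w) ≥ c₀ ≥ 0`, `βU ≥ −u₀` and
`1 ≤ R² · (1 − (1−c₀)/2 − (1−c₀²)/(1+e^{−u₀/2})²)` with `R > 0`, then `siteRatio β U (w/β) ≤ R`
(e.g. `R = e^{a₁^N(φ₀)}` with `c₀ = cos φ₀`).
[this programme: bounds.tex §13, Lemma 13.1 (c) (`|z(ζ)| ≥ e^{−a₁} z(s)` on the tube), N-sector form] -/
theorem siteRatio_le_of_arc (β U : ℝ) (hβ : β ≠ 0) (w : ℂ) (c₀ u₀ R : ℝ) (hc₀ : 0 ≤ c₀)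
    (hc : c₀ ≤ Real.cos w.im) (hv : -u₀ ≤ β * U) (hR : 0 < R)
    (hfloor : 1 ≤ R ^ 2 * (1 - (1 - c₀) / 2 - (1 - c₀ ^ 2) / (1 + Real.exp (-(u₀ / 2))) ^ 2)) :
    siteRatio (β : ℂ) (U : ℂ) (w / β) ≤ R := by
  rw [siteRatio_div_eq β U hβ w]
  set z := 1 + 2 * Real.exp w.re + Real.exp (2 * w.re - β * U) with hzdef
  set F := 1 - (1 - c₀) / 2 - (1 - c₀ ^ 2) / (1 + Real.exp (-(u₀ / 2))) ^ 2 with hF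
  set N := ‖1 + 2 * cexp w + cexp (2 * w - (β * U : ℝ))‖ with hN
  have h : z ^ 2 * F ≤ N ^ 2 := normSq_atomicC_arc_lower w (β * U) c₀ u₀ hc₀ hc hv
  have hz : 0 < z := by positivity
  have hN0 : 0 ≤ N := norm_nonneg _
  -- `z² ≤ R² z² F ≤ R² N²`, hence `z ≤ R N`
  have h1 : z ^ 2 ≤ (R * N) ^ 2 := by
    have : z ^ 2 * 1 ≤ z ^ 2 * (R ^ 2 * F) := mul_le_mul_of_nonneg_left hfloor (by positivity)
    nlinarith [mul_le_mul_of_nonneg_left h (le_of_lt (pow_pos hR 2))]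
  have h2 : z ≤ R * N := (pow_le_pow_iff_left₀ hz.le (by positivity) two_ne_zero).1 h1
  rcases hN0.lt_or_eq with hNpos | hN0'
  · rw [div_le_iff₀ hNpos]; exact h2
  · rw [← hN0']; simp [hR.le]

/-- **Off the arc, for the tree's one-site partition function.** If `cos (Im w) ≤ c₀ ≤ 1` and
`|βU| ≤ u₀` then `‖z₀(β, U, w/β)‖ ≤ z(Re w) · exp (−κ)` with
`κ = (1−c₀) · n(2−n) / ((1+e^{u₀})(1+e^{u₀/2}))`, `n = (2e^{Re w} + 2e^{2 Re w − βU})/z(Re w)` the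
atomic density at the real fugacity `Re w`.
[this programme: bounds.tex §13, Lemma 13.2 (the volume factor `e^{−κ₁}` per site), N-sector form] -/
theorem norm_atomicPartitionFn_le_mul_exp_neg_offarc (β U : ℝ) (hβ : β ≠ 0) (w : ℂ) (c₀ u₀ : ℝ)
    (hc : Real.cos w.im ≤ c₀) (hc1 : c₀ ≤ 1) (hv : |β * U| ≤ u₀) :
    ‖atomicPartitionFn (β : ℂ) (U : ℂ) (w / β)‖
      ≤ (1 + 2 * Real.exp w.re + Real.exp (2 * w.re - β * U))
        * Real.exp (-((1 - c₀) * (((2 * Real.exp w.re + 2 * Real.exp (2 * w.re - β * U))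
              / (1 + 2 * Real.exp w.re + Real.exp (2 * w.re - β * U)))
            * (2 - (2 * Real.exp w.re + 2 * Real.exp (2 * w.re - β * U))
              / (1 + 2 * Real.exp w.re + Real.exp (2 * w.re - β * U))))
            / ((1 + Real.exp u₀) * (1 + Real.exp (u₀ / 2))))) := by
  rw [atomicPartitionFn_div_eq β U hβ w]
  exact norm_atomicC_le_mul_exp_neg_offarc w (β * U) c₀ u₀ hc hc1 hv

end Summit.HubbardSuperconductivity.HubbardLadder.Bounds

end
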